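import Summits.QuantumAdvantage.QuantumAdvantage.Theorems.CubicForrelationNearExactIsExactTwelveWeightGapNone

/-!
# Crux `CubicForrelation.NearExactIsExact` (stmt-QuantumAdvantage-14043) — tools for the Kasami–Tokura gap of cubics, I: restriction to a
  hyperplane and derivative intersections, uniform in `m`

Certificate seat `b2b-cforr-cert` (gen 16).  HONEST FRAMING: elementary coding-theory TOOLS (standard axioms, uniform in the number of bits)
for the brick "no cubic Boolean function on `m ≤ 12` bits has weight strictly between `3·2^{m-4}` and `7·2^{m-5}`" (`…KtGapCubic.lean`),
the Kasami–Tokura gap `(1.5d, 1.75d)` of `RM(3,m)` needed by the TYPE-O branch of the `n = 12` window analysis below `940/1024`.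
NOT summit progress.

* `ktg_restrict`: the restriction of a degree-`≤ d` function on `k+1` bits to an affine hyperplane `{⟨x,z⟩ = b}` is — through the chart
  that solves for a pivot coordinate `i₀` with `z_{i₀} = 1` — a degree-`≤ d` function on `k` bits with the same number of ones
  (`nf_isDegLeFun_subst` with coordinates of total degree `≤ 1`).
* `ktg_deriv_values`: for a cubic support `E` with `32·#E < 7·2^m` and any `a`, `I(a) = #(E ∩ (E ⊕ a))` satisfies
  `16 I(a) + 3·2^m = 16 #E` or `8 I(a) + 2^m = 8 #E` or `I(a) = #E` (the quadratic `c ⊕ c(·⊕a)` has Walsh value `2^m − 4#E + 4I(a) > 2^m/8`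
  at `0`, and quadratic spectra are plateaued, `stub_quadWalshPlateau`).
* `ktg_sum_I` (`Σ_a I(a) = #E²`), `ktg_sq_dvd` (`2^m ∣ 16·#E²`), `ktg_two_pow_dvd_of_sq` (`2^a ∣ w² ⇒ 2^{⌈a/2⌉} ∣ w`).

References: T. Kasami, N. Tokura, *On the weight structure of Reed–Muller codes*, IEEE Trans. IT 16 (1970) 752–759; F. J. MacWilliams,
N. J. A. Sloane (1977) Ch. 15 §3; C. Carlet (2021) §2.2.  Everything below is proved from Mathlib and the tree; axioms are the standard three.
-/

set_option linter.dupNamespace false -- D-0017: single-problem summit ⇒ `QuantumAdvantage.QuantumAdvantage` by design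

noncomputable section

namespace Summit.QuantumAdvantage.QuantumAdvantage.Theorems.CubicForrelation.NearExactIsExact

open Finset
open Literature.Computability.QuantumComplexity
open Literature.Computability.QuantumComplexity.BuzetChailloux (bxor zeroVec bxor_bxor_cancel_left bxor_zeroVec zeroVec_bxor bxor_comm
  bxor_self twist_zeroVec_right twist_bxor_right)
open Literature.Computability.QuantumComplexity.DerivativeWalsh (W twist_bxor_left)
open Literature.Computability.QuantumComplexity.Simon (twist_eq_one_or)
open Summit.QuantumAdvantage.QuantumAdvantage.Theorems.SignedCubicForrelationNotPrBPP (knf_isDegLeFun_ip)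

/-! ### Restriction to an affine hyperplane through a pivot coordinate -/

/-- Splitting the count `#{i : x_i ∧ z_i}` over `Fin (k+1)` at a pivot `i₀`. [folklore] -/
theorem ktg_card_and_split {k : ℕ} (x z : Fin (k + 1) → Bool) (i₀ : Fin (k + 1)) :
    #(univ.filter fun i => (x i && z i) = true) =
      (if (x i₀ && z i₀) = true then 1 else 0) + #(univ.filter fun j : Fin k => (x (i₀.succAbove j) && z (i₀.succAbove j)) = true) := by
  rw [card_filter, card_filter, Fin.sum_univ_succAbove _ i₀]

/-- Parity bookkeeping for the chart: the inserted bit `b ⊕ [n odd]` makes the total count `≡ b`. [folklore] -/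
theorem ktg_xor_parity (b : Bool) (n : ℕ) :
    decide (Odd ((if (b ^^ decide (Odd n)) = true then 1 else 0) + n)) = b := by
  rcases Nat.even_or_odd n with he | ho
  · have hno : ¬ Odd n := Nat.not_odd_iff_even.2 he
    cases b
    · simp [hno]
    · simp [hno, he]
  · have hne : ¬ Even n := Nat.not_even_iff_odd.2 ho
    cases b
    · simp [ho, hne, Nat.odd_add]
    · simp [ho]

/-- Converse bookkeeping: if `[x₀] + n ≡ b` then `b ⊕ [n odd] = x₀`. [folklore] -/
theorem ktg_xor_parity' (x₀ b : Bool) (n : ℕ) (h : decide (Odd ((if x₀ = true then 1 else 0) + n)) = b) :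
    (b ^^ decide (Odd n)) = x₀ := by
  subst h
  rcases Nat.even_or_odd n with he | ho
  · have hno : ¬ Odd n := Nat.not_odd_iff_even.2 he
    cases x₀
    · simp
    · simp [hno, he]
  · have hne : ¬ Even n := Nat.not_even_iff_odd.2 ho
    cases x₀
    · simp
    · simp [ho, hne, Nat.odd_add]

/-- **Restriction to an affine hyperplane.**  For `c` of degree `≤ d` on `k + 1` bits, a covector `z` with a pivot `z_{i₀} = 1` and
`b ∈ 𝔽₂`, the restriction of `c` to `{x : ⟨x, z⟩ = b}` — read through the affine chart `y ↦ x` that copies `y` off `i₀` and solves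
`x_{i₀} = b ⊕ ⟨y, z'⟩` — is a function of degree `≤ d` on `k` bits with exactly `#{x : c x = 1, ⟨x,z⟩ = b}` ones.
[folklore; affine invariance of `RM(d, ·)`] -/
theorem ktg_restrict {k d : ℕ} (c : (Fin (k + 1) → Bool) → Bool) (hc : IsDegLeFun d c) (z : Fin (k + 1) → Bool)
    (i₀ : Fin (k + 1)) (hz : z i₀ = true) (b : Bool) :
    ∃ c' : (Fin k → Bool) → Bool, IsDegLeFun d c' ∧
      #(univ.filter fun y => c' y = true) =
        #(univ.filter fun x => c x = true ∧ decide (Odd #(univ.filter fun i => (x i && z i) = true)) = b) := by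
  classical
  -- the chart
  set v : (Fin k → Bool) → Bool := fun y =>
    b ^^ decide (Odd #(univ.filter fun j : Fin k => (y j && z (i₀.succAbove j)) = true)) with hvdef
  set s : (Fin k → Bool) → (Fin (k + 1) → Bool) := fun y => Fin.insertNth (α := fun _ => Bool) i₀ (v y) y with hsdef
  have hs0 : ∀ y, s y i₀ = v y := fun y => by simp [hsdef]
  have hsj : ∀ y (j : Fin k), s y (i₀.succAbove j) = y j := fun y j => by simp [hsdef]
  -- the chart lands in the hyperplane
  have hsH : ∀ y, decide (Odd #(univ.filter fun i => (s y i && z i) = true)) = b := by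
    intro y
    rw [ktg_card_and_split _ _ i₀, hs0, hz, Bool.and_true]
    simp_rw [hsj]
    exact ktg_xor_parity b _
  -- and is onto it
  have hsr : ∀ x : Fin (k + 1) → Bool, decide (Odd #(univ.filter fun i => (x i && z i) = true)) = b →
      s (Fin.removeNth (α := fun _ => Bool) i₀ x) = x := by
    intro x hx
    rw [ktg_card_and_split _ _ i₀, hz, Bool.and_true] at hx
    have hv : v (Fin.removeNth (α := fun _ => Bool) i₀ x) = x i₀ := by
      simp only [hvdef, Fin.removeNth]
      exact ktg_xor_parity' (x i₀) b _ hx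
    simp only [hsdef]
    rw [hv]
    exact Fin.insertNth_self_removeNth (α := fun _ => Bool) i₀ x
  refine ⟨fun y => c (s y), ?_, ?_⟩
  · -- degree: every chart coordinate is a polynomial of total degree ≤ 1
    refine nf_isDegLeFun_subst
      (Fin.insertNth (α := fun _ => MvPolynomial (Fin k) (ZMod 2)) i₀
        (MvPolynomial.C (if b = true then (1 : ZMod 2) else 0) +
          ∑ j : Fin k, MvPolynomial.C (if z (i₀.succAbove j) = true then (1 : ZMod 2) else 0) * MvPolynomial.X j)
        (fun j => MvPolynomial.X j)) (fun i => ?_) s (fun y i => ?_) hc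
    · rcases Fin.eq_self_or_eq_succAbove i₀ i with hi | ⟨j, rfl⟩
      · rw [hi, Fin.insertNth_apply_same]
        refine (MvPolynomial.totalDegree_add _ _).trans (max_le ?_ ?_)
        · rw [MvPolynomial.totalDegree_C]; exact Nat.zero_le _
        · exact Literature.Computability.AlgebraicComplexity.totalDegree_sum_C_mul_X_le _
      · rw [Fin.insertNth_apply_succAbove]
        exact (MvPolynomial.totalDegree_X (R := ZMod 2) j).le
    · rcases Fin.eq_self_or_eq_succAbove i₀ i with hi | ⟨j, rfl⟩
      · rw [hi, Fin.insertNth_apply_same, hs0, map_add, MvPolynomial.eval_C, map_sum]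
        simp_rw [map_mul, MvPolynomial.eval_C, MvPolynomial.eval_X]
        have e : ∀ j : Fin k, (if z (i₀.succAbove j) = true then (1 : ZMod 2) else 0) * (if y j = true then (1 : ZMod 2) else 0) =
            if (y j && z (i₀.succAbove j)) = true then 1 else 0 := by
          intro j; cases y j <;> cases z (i₀.succAbove j) <;> simp
        rw [sum_congr rfl fun j _ => e j, sum_boole]
        set n := #(univ.filter fun j : Fin k => (y j && z (i₀.succAbove j)) = true) with hn
        have hcast : ((n : ℕ) : ZMod 2) = if Odd n then 1 else 0 := by
          split_ifs with ho
          · exact ZMod.natCast_eq_one_iff_odd.2 ho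
          · exact ZMod.natCast_eq_zero_iff_even.2 (Nat.not_odd_iff_even.1 ho)
        rw [hcast]
        simp only [hvdef]
        by_cases ho : Odd n
        · rw [← hn]
          cases b
          · simp [ho]
          · simp [ho]; decide
        · rw [← hn]
          cases b
          · simp [ho]
          · simp [ho]
      · rw [Fin.insertNth_apply_succAbove, MvPolynomial.eval_X, hsj]
  · -- counting through the chart
    refine card_nbij' s (fun x => Fin.removeNth (α := fun _ => Bool) i₀ x) (fun y hy => ?_) (fun x hx => ?_)
      (fun y _ => Fin.removeNth_insertNth (α := fun _ => Bool) i₀ (v y) y) (fun x hx => ?_)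
    · rw [mem_coe, mem_filter] at hy
      rw [mem_coe, mem_filter]
      exact ⟨mem_univ _, hy.2, hsH y⟩
    · rw [mem_coe, mem_filter] at hx
      rw [mem_coe, mem_filter]
      refine ⟨mem_univ _, ?_⟩
      show c (s (Fin.removeNth (α := fun _ => Bool) i₀ x)) = true
      rw [hsr x hx.2.2]; exact hx.2.1
    · rw [mem_coe, mem_filter] at hx
      exact hsr x hx.2.2

/-! ### Derivative intersections of a light cubic support (general `m`) -/

/-- **Derivative intersections.**  For a cubic `c` on `m` bits with `32·#E < 7·2^m`, `E = {c = 1}`, and any `a`: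
`16·#(E ∩ (E ⊕ a)) + 3·2^m = 16·#E`, or `8·#(E ∩ (E ⊕ a)) + 2^m = 8·#E`, or `#(E ∩ (E ⊕ a)) = #E`
(the quadratic `c ⊕ c(·⊕a)` has Walsh value `2^m − 4#E + 4#(E ∩ (E⊕a)) > 2^m/8` at `0`, and quadratic spectra are plateaued:
`stub_quadWalshPlateau`). [this work; Kasami–Tokura bookkeeping] -/
theorem ktg_deriv_values {m : ℕ} (c : (Fin m → Bool) → Bool) (hc : IsDegLeFun 3 c)
    (h2 : 32 * #(univ.filter fun x => c x = true) < 7 * 2 ^ m) (a : Fin m → Bool) :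
    16 * #((univ.filter fun x => c x = true).filter fun x => bxor x a ∈ univ.filter fun x => c x = true) + 3 * 2 ^ m =
        16 * #(univ.filter fun x => c x = true) ∨
      8 * #((univ.filter fun x => c x = true).filter fun x => bxor x a ∈ univ.filter fun x => c x = true) + 2 ^ m =
        8 * #(univ.filter fun x => c x = true) ∨
      #((univ.filter fun x => c x = true).filter fun x => bxor x a ∈ univ.filter fun x => c x = true) =
        #(univ.filter fun x => c x = true) := by
  classical
  set S := univ.filter (fun x : Fin m → Bool => c x = true) with hSdef
  have hmemS : ∀ x, x ∈ S ↔ c x = true := fun x => by simp [hSdef]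
  set I := #(S.filter fun x => bxor x a ∈ S) with hIdef
  have hIle : I ≤ #S := card_filter_le _ _
  -- trivial case `S = ∅`
  by_cases hS0 : #S = 0
  · right; right; omega
  -- `m ≥ 3`
  have hSle : #S ≤ 2 ^ m := by
    calc #S ≤ #(univ : Finset (Fin m → Bool)) := card_le_univ _
      _ = 2 ^ m := by rw [card_univ, Fintype.card_fun, Fintype.card_bool, Fintype.card_fin]
  obtain ⟨j, rfl⟩ : ∃ j, m = j + 3 := by
    rcases Nat.lt_or_ge m 3 with hm | hm
    · exfalso
      have : 2 ^ m ≤ 2 ^ 2 := Nat.pow_le_pow_right (by norm_num) (by omega)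
      omega
    · exact ⟨m - 3, by omega⟩
  have hN : (2 : ℝ) ^ (j + 3) = 8 * 2 ^ j := by ring
  have hind : ∀ x, signOf (c x) = 1 - 2 * (if x ∈ S then (1 : ℝ) else 0) := by
    intro x
    by_cases hx : x ∈ S
    · rw [if_pos hx]; have hc' := (hmemS x).1 hx; unfold signOf; rw [if_pos hc']; norm_num
    · rw [if_neg hx]
      have hc' : ¬ c x = true := fun h => hx ((hmemS x).2 h)
      unfold signOf; rw [if_neg hc']; norm_num
  have hD : IsDegLeFun 2 (fun x => c x ^^ c (bxor x a)) := stub_derivDegree (j + 3) 2 c a hc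
  obtain ⟨s, hs⟩ := stub_quadWalshPlateau (j + 3) _ hD
  have hW0 : W (fun x => signOf (c x ^^ c (bxor x a))) zeroVec = 2 ^ (j + 3) - 4 * (#S : ℝ) + 4 * (I : ℝ) := by
    unfold W
    simp_rw [twist_zeroVec_right, mul_one, signOf_xor]
    rw [sum_congr rfl fun x _ => by rw [hind x, hind (bxor x a)]]
    have e1 : ∀ x : Fin (j + 3) → Bool, (1 - 2 * (if x ∈ S then (1 : ℝ) else 0)) * (1 - 2 * (if bxor x a ∈ S then (1 : ℝ) else 0)) =
        1 - 2 * (if x ∈ S then (1 : ℝ) else 0) - 2 * (if bxor x a ∈ S then (1 : ℝ) else 0) +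
          4 * (if (x ∈ S ∧ bxor x a ∈ S) then (1 : ℝ) else 0) := by
      intro x; by_cases h1 : x ∈ S <;> by_cases h2 : bxor x a ∈ S <;> norm_num [h1, h2]
    rw [sum_congr rfl fun x _ => e1 x, sum_add_distrib, sum_sub_distrib, sum_sub_distrib, sum_const, card_univ, Fintype.card_fun,
      Fintype.card_bool, Fintype.card_fin, ← mul_sum, ← mul_sum, ← mul_sum, sum_boole, sum_boole, sum_boole]
    have c1 : #(univ.filter fun x : Fin (j + 3) → Bool => x ∈ S) = #S := by
      rw [show (univ.filter fun x : Fin (j + 3) → Bool => x ∈ S) = S by ext x; simp]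
    have c2 : #(univ.filter fun x : Fin (j + 3) → Bool => bxor x a ∈ S) = #S := by
      refine card_nbij' (fun x => bxor x a) (fun x => bxor x a) (fun x hx => ?_) (fun x hx => ?_)
        (fun x _ => by show bxor (bxor x a) a = x; rw [iw_bxor_assoc, bxor_self, bxor_zeroVec])
        (fun x _ => by show bxor (bxor x a) a = x; rw [iw_bxor_assoc, bxor_self, bxor_zeroVec])
      · rw [mem_coe, mem_filter] at hx; exact hx.2
      · rw [mem_coe] at hx; rw [mem_coe, mem_filter, iw_bxor_assoc, bxor_self, bxor_zeroVec]; exact ⟨mem_univ _, hx⟩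
    have c3 : #(univ.filter fun x : Fin (j + 3) → Bool => x ∈ S ∧ bxor x a ∈ S) = I := by
      simp only [I]; congr 1; ext x; simp
    rw [c1, c2, c3]
    norm_num; ring
  have hS2 : 32 * (#S : ℝ) < 7 * 2 ^ (j + 3) := by exact_mod_cast h2
  have hIle' : (I : ℝ) ≤ #S := by exact_mod_cast hIle
  have hI0 : (0 : ℝ) ≤ I := by positivity
  have hPj : (0 : ℝ) < 2 ^ j := by positivity
  rcases hs zeroVec with h0 | hsq
  · exfalso
    rw [hW0, hN] at h0
    linarith
  · rw [hW0] at hsq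
    have h4 : (4 : ℝ) ^ s = ((2 : ℝ) ^ s) ^ 2 := by
      rw [show (4 : ℝ) = 2 ^ 2 by norm_num, ← pow_mul, mul_comm, pow_mul]
    rw [h4] at hsq
    have hpos : (0 : ℝ) ≤ 2 ^ (j + 3) - 4 * (#S : ℝ) + 4 * (I : ℝ) := by rw [hN]; linarith
    have h2s : 2 ^ (j + 3) - 4 * (#S : ℝ) + 4 * (I : ℝ) = (2 : ℝ) ^ s :=
      (pow_left_inj₀ hpos (by positivity) (by norm_num : (2 : ℕ) ≠ 0)).1 hsq
    have hs_le : s ≤ j + 3 := by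
      by_contra h
      push Not at h
      have : (2 : ℝ) ^ (j + 4) ≤ 2 ^ s := pow_le_pow_right₀ (by norm_num) h
      rw [pow_succ] at this
      linarith
    have hs_ge : j + 1 ≤ s := by
      by_contra h
      push Not at h
      have h29 : (2 : ℝ) ^ s ≤ 2 ^ j := pow_le_pow_right₀ (by norm_num) (by omega)
      rw [hN] at h2s
      linarith
    obtain ⟨i, hi, rfl⟩ : ∃ i, i ≤ 2 ∧ s = j + 1 + i := ⟨s - (j + 1), by omega, by omega⟩
    have e : (2 : ℝ) ^ (j + 1 + i) = 2 * 2 ^ j * 2 ^ i := by ring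
    rw [e, hN] at h2s
    interval_cases i
    · left
      have h' : (16 * I + 3 * 2 ^ (j + 3) : ℝ) = 16 * #S := by rw [hN]; linarith
      exact_mod_cast h'
    · right; left
      have h' : (8 * I + 2 ^ (j + 3) : ℝ) = 8 * #S := by rw [hN]; linarith
      exact_mod_cast h'
    · right; right
      have h' : (I : ℝ) = #S := by linarith
      exact_mod_cast h'

/-- **`Σ_a #(E ∩ (E ⊕ a)) = #E²`** for any finite set `E ⊆ 𝔽₂^m` (count `E × E` along `(x, y) ↦ x ⊕ y`). [folklore] -/
theorem ktg_sum_I {m : ℕ} (S : Finset (Fin m → Bool)) :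
    ∑ a, #(S.filter fun x => bxor x a ∈ S) = #S * #S := by
  classical
  set P2 := S ×ˢ S with hP2
  have hJI : ∀ a, #(P2.filter fun q => bxor q.1 q.2 = a) = #(S.filter fun x => bxor x a ∈ S) := by
    intro a
    refine card_nbij' (fun q => q.1) (fun x => (x, bxor x a)) (fun q hq => ?_) (fun x hx => ?_) (fun q hq => ?_) (fun x _ => rfl)
    · rw [mem_coe, mem_filter, hP2, mem_product] at hq
      rw [mem_coe, mem_filter]
      refine ⟨hq.1.1, ?_⟩
      rw [← hq.2, bxor_bxor_cancel_left]; exact hq.1.2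
    · rw [mem_coe, mem_filter] at hx
      rw [mem_coe, mem_filter, hP2, mem_product]
      exact ⟨⟨hx.1, hx.2⟩, bxor_bxor_cancel_left _ _⟩
    · rw [mem_coe, mem_filter] at hq
      obtain ⟨-, h⟩ := hq
      show (q.1, bxor q.1 a) = q
      rw [← h, bxor_bxor_cancel_left]
  have h := card_eq_sum_card_fiberwise (s := P2) (t := (univ : Finset (Fin m → Bool))) (f := fun q => bxor q.1 q.2)
    (fun q _ => mem_univ _)
  rw [hP2, card_product] at h
  rw [h]
  exact sum_congr rfl fun a _ => by rw [← hJI a]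

/-- **`2^m ∣ 16·#E²`** for a cubic support `E` on `m` bits with `32·#E < 7·2^m` (`ktg_deriv_values` mod `2^m`, summed over `a`).
[this work] -/
theorem ktg_sq_dvd {m : ℕ} (c : (Fin m → Bool) → Bool) (hc : IsDegLeFun 3 c)
    (h2 : 32 * #(univ.filter fun x => c x = true) < 7 * 2 ^ m) :
    2 ^ m ∣ 16 * (#(univ.filter fun x => c x = true) * #(univ.filter fun x => c x = true)) := by
  classical
  set S := univ.filter (fun x : Fin m → Bool => c x = true) with hSdef
  have key : ∀ a, 16 * #(S.filter fun x => bxor x a ∈ S) + 3 * 2 ^ m = 16 * #S ∨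
      8 * #(S.filter fun x => bxor x a ∈ S) + 2 ^ m = 8 * #S ∨ #(S.filter fun x => bxor x a ∈ S) = #S :=
    fun a => ktg_deriv_values c hc h2 a
  have hq : ∀ a, ∃ q : ℕ, 16 * #(S.filter fun x => bxor x a ∈ S) + q * 2 ^ m = 16 * #S := by
    intro a
    rcases key a with h | h | h
    · exact ⟨3, h⟩
    · exact ⟨2, by omega⟩
    · exact ⟨0, by rw [h]; ring⟩
  choose q hq using hq
  have hsum : 16 * (#S * #S) + (∑ a, q a) * 2 ^ m = 2 ^ m * (16 * #S) := by
    rw [← ktg_sum_I S, mul_sum, sum_mul, ← sum_add_distrib, sum_congr rfl fun a _ => hq a, sum_const, card_univ,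
      Fintype.card_fun, Fintype.card_bool, Fintype.card_fin, smul_eq_mul]
  have hdvd : 2 ^ m ∣ 16 * (#S * #S) + (∑ a, q a) * 2 ^ m := by rw [hsum]; exact dvd_mul_right _ _
  exact (Nat.dvd_add_left (dvd_mul_left _ _)).1 hdvd

/-- Powers of two dividing a square: `2^a ∣ w² ⇒ 2^{⌈a/2⌉} ∣ w`. [folklore] -/
theorem ktg_two_pow_dvd_of_sq {a w : ℕ} (h : 2 ^ a ∣ w * w) : 2 ^ ((a + 1) / 2) ∣ w := by
  rcases Nat.eq_zero_or_pos w with rfl | hw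
  · exact dvd_zero _
  obtain ⟨j, o, ho, rfl⟩ := Nat.exists_eq_two_pow_mul_odd hw.ne'
  have hoo : Odd (o * o) := ho.mul ho
  have hcop : Nat.Coprime (2 ^ a) (o * o) := (Nat.coprime_two_left.2 hoo).pow_left a
  have h' : 2 ^ a ∣ 2 ^ (2 * j) * (o * o) := by
    rw [show 2 ^ (2 * j) * (o * o) = 2 ^ j * o * (2 ^ j * o) by ring]; exact h
  have h2 : 2 ^ a ∣ 2 ^ (2 * j) := hcop.dvd_of_dvd_mul_right h'
  have hle : a ≤ 2 * j := (Nat.pow_dvd_pow_iff_le_right (by norm_num)).1 h2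
  exact (pow_dvd_pow 2 (by omega : (a + 1) / 2 ≤ j)).trans (dvd_mul_right _ _)

end Summit.QuantumAdvantage.QuantumAdvantage.Theorems.CubicForrelation.NearExactIsExact

end
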